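import Summits.Ventures.CertifiedManyBodySolver.Observables.SourcedOrderParameterCeiling
import Literature.MathematicalPhysics.QuantumLattice.HubbardNNNHoppingTorusLimitCorrelator
import Literature.MathematicalPhysics.QuantumLattice.HubbardModelParticleHoleProofs
import Literature.MathematicalPhysics.QuantumLattice.FinDimSpectrumProofs
import HarnessLib

/-!
# F-B′ inputs: the source-free grand-canonical energy is capped by ANY certified CANONICAL upper bound
# (Legendre inequality), so the order-parameter ceiling needs only `e₀(n) ≤ hi` and a sourced LOWER bound

HONEST FRAMING: first certified bounds on pairing observables; not a superconductivity verdict; every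
number certified (two lineages + referee) or labelled float. Crew hubbard-obs (D-0042), seat hubbard-obs-p1
(`prover-hubbard-obs-p1-g0-0`); companion of `Observables/SourcedOrderParameterCeiling.lean` (p401557), which
proved `dWaveOrderParameter U μ ≤ (u₀ − ℓ)/(2(H − h))` from an eventual window `E_{L+1}(0) ≤ u₀ (L+1)²`,
`ℓ (L+1)² ≤ E_{L+1}(H)`. Here the UPPER hypothesis is discharged "upper-crew-independently" (TARGET.md §4 F-B′):

* `groundEnergy_hubbardTorusWith_le_sector` (finite torus, Legendre / variational): for every density
  `0 ≤ n ≤ 2`, `E^{GC}_L(μ) := groundEnergy (H_L − μN̂) ≤ E₀(L; rectN n L) − μ · rectN n L` — the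
  grand-canonical ground energy is below the canonical sector energy minus `μN` (Rayleigh quotient of the
  unit sector ground state, on which `N̂ = N`);
* `eventually_groundEnergy_dWaveSourceTorus_zero_le` (thermodynamic limit): for `U ≥ 0`, `0 ≤ n < 2` and any
  `u₀ > energyDensityTT' 1 0 U n − μ n`, eventually `E_{L+1}(0) = groundEnergy (dWaveSourceTorus (L+1) U μ 0) ≤ u₀ (L+1)²`
  (`E₀(L; rectN n L)/L² → energyDensityTT'`, `rectN n L/L² → n`);
* `dWaveOrderParameter_le_of_canonical_upper_of_sourced_lower` — **the F-B′ ceiling in the form the cell can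
  feed**: `energyDensityTT' 1 0 U n ≤ hi` (a typed M3/M2 energy UPPER row, e.g. #354 at `(8, 7/8, 0)`), a real
  `μ`, `0 < h < H`, and an eventual certified LOWER bound `ℓ (L+1)² ≤ E_{L+1}(H)` for the SOURCED torus
  Hamiltonian give `dWaveOrderParameter U μ ≤ (hi − μ n − ℓ)/(2(H − h))`, for EVERY density `n ∈ [0, 2)`
  (optimise `n` freely; no μ-licence, no sourced upper bound).
Theorem-only; zero compute; no named fact; no `sorry`. The missing input of record is `ℓ` (a gauge-broken
translation-invariant window certificate for `h₀ − μ n − H(Φ + Φ†)` valid on all large tori — its soundness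
theorem is NOT in the tree; TARGET-p1 §5).
-/

noncomputable section

namespace Summit.Ventures.CertifiedManyBodySolver.Observables

open Matrix Literature.MathematicalPhysics.QuantumLattice Literature.Probability.LatticeModels
open Literature.MathematicalPhysics.QuantumLattice.HubbardWave0 ThermodynamicLimit Filter Topology
open scoped BigOperators ComplexOrder

/-- **Legendre inequality on a finite torus**: the grand-canonical ground energy of `H_L − μN̂`
(`hubbardTorusWith 2 L 1 U μ`, hopping `1`) is at most the canonical sector ground energy at density `n`
minus `μ · rectN n L`, for every `0 ≤ n ≤ 2` (Rayleigh quotient of a unit ground state of the sector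
`(rectN n L, S^z = 0)`, where `N̂ = rectN n L`). Tasaki (2020) §2.1 (variational principle). -/
theorem groundEnergy_hubbardTorusWith_le_sector (L : ℕ) [NeZero L] (U μ : ℝ) {n : ℝ} (hn0 : 0 ≤ n) (hn2 : n ≤ 2) :
    (hubbardTorusWith 2 L 1 U μ).groundEnergy ≤
      groundEnergy (hubbardTorusTT' L 1 0 U) (rectN n L) - μ * (rectN n L : ℝ) := by
  obtain ⟨ψ, hψ, h1⟩ := exists_unit_isGroundStateInSector_hubbardTorusTT' L 1 0 U hn0 hn2
  have hray := Matrix.groundEnergy_le_rayleigh_holds (isHermitian_hubbardTorusWith L 1 U μ) ψ h1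
  have hN : IsNParticle (rectN n L) ψ := ((mem_szSector_iff _ _ _).1 hψ.1).1
  have hE := re_rayleigh_hubbardTorusTT'_of_isGroundStateInSector_rectN L 1 0 U hn0 hn2 hψ h1
  have hsplit : (star ψ ⬝ᵥ (hubbardTorusWith 2 L 1 U μ *ᵥ ψ)).re =
      (star ψ ⬝ᵥ (hubbardTorusTT' L 1 0 U *ᵥ ψ)).re - μ * (rectN n L : ℝ) := by
    rw [hubbardTorusWith_eq, ← hubbardTorusTT'_zero, sub_mulVec, smul_mulVec,
      totalNumber_mulVec_of_isNParticle hN, dotProduct_sub, dotProduct_smul, dotProduct_smul, h1,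
      Complex.sub_re, smul_eq_mul, smul_eq_mul, mul_one]
    simp
  rw [hsplit, hE] at hray
  exact hray

/-- **Thermodynamic limit of the Legendre inequality**: for `U ≥ 0`, `0 ≤ n < 2`, every `μ` and every
`u₀ > energyDensityTT' 1 0 U n − μ n`, the source-free grand-canonical torus ground energies eventually satisfy
`groundEnergy (dWaveSourceTorus (L+1) U μ 0) ≤ u₀ (L+1)²`. Ruelle (1969) §3.4; Tasaki (2020) §2.1. -/
theorem eventually_groundEnergy_dWaveSourceTorus_zero_le {U : ℝ} (hU : 0 ≤ U) (μ : ℝ) {n : ℝ} (hn0 : 0 ≤ n)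
    (hn2 : n < 2) {u₀ : ℝ} (hu₀ : energyDensityTT' 1 0 U n - μ * n < u₀) :
    ∀ᶠ L : ℕ in atTop, (dWaveSourceTorus (L + 1) U μ 0).groundEnergy ≤ u₀ * (((L + 1 : ℕ) : ℝ)) ^ 2 := by
  -- `E₀(rectN)/L² − μ rectN/L² → e − μ n` along `L + 1`
  have hE : Tendsto (fun L : ℕ => groundEnergy (hubbardTorusTT' (L + 1) 1 0 U) (rectN n (L + 1)) /
      (((L + 1 : ℕ) : ℝ)) ^ 2) atTop (𝓝 (energyDensityTT' 1 0 U n)) :=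
    (tendsto_energyDensityTT'_torus 1 0 hU hn0 hn2).comp (tendsto_add_atTop_nat 1)
  have hN : Tendsto (fun L : ℕ => (rectN n (L + 1) : ℝ) / (((L + 1 : ℕ) : ℝ)) ^ 2) atTop (𝓝 n) :=
    (tendsto_rectN_div_sq hn0).comp (tendsto_add_atTop_nat 1)
  have hlim : Tendsto (fun L : ℕ => groundEnergy (hubbardTorusTT' (L + 1) 1 0 U) (rectN n (L + 1)) /
      (((L + 1 : ℕ) : ℝ)) ^ 2 - μ * ((rectN n (L + 1) : ℝ) / (((L + 1 : ℕ) : ℝ)) ^ 2)) atTop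
      (𝓝 (energyDensityTT' 1 0 U n - μ * n)) := hE.sub (hN.const_mul μ)
  filter_upwards [hlim.eventually (gt_mem_nhds hu₀)] with L hL
  have hpos : (0 : ℝ) < (((L + 1 : ℕ) : ℝ)) ^ 2 := by positivity
  have hfin := groundEnergy_hubbardTorusWith_le_sector (L + 1) U μ hn0 hn2.le
  rw [dWaveSourceTorus_zero]
  -- divide the finite-torus inequality by `(L+1)²`
  have hdiv : groundEnergy (hubbardTorusTT' (L + 1) 1 0 U) (rectN n (L + 1)) - μ * (rectN n (L + 1) : ℝ) ≤
      u₀ * (((L + 1 : ℕ) : ℝ)) ^ 2 := by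
    have h' : (groundEnergy (hubbardTorusTT' (L + 1) 1 0 U) (rectN n (L + 1)) - μ * (rectN n (L + 1) : ℝ)) /
        (((L + 1 : ℕ) : ℝ)) ^ 2 < u₀ := by
      rw [sub_div, mul_div_assoc]
      exact hL
    exact ((div_lt_iff₀ hpos).1 h').le
  exact hfin.trans hdiv

/-- **F-B′ in the form the cell can feed.** For `U ≥ 0`, any density `0 ≤ n < 2` with a certified
thermodynamic-limit UPPER bound `energyDensityTT' 1 0 U n ≤ hi` (a typed energy row), any chemical potential `μ`,
sources `0 < h < H`, and an eventual certified LOWER bound `ℓ (L+1)² ≤ groundEnergy (dWaveSourceTorus (L+1) U μ H)`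
for the SOURCED grand-canonical torus Hamiltonian:
`dWaveOrderParameter U μ ≤ (hi − μ n − ℓ)/(2(H − h))`. No μ-licence and no sourced upper bound enter.
Koma–Tasaki 1994 §1 (order parameter with a symmetry-breaking field). -/
theorem dWaveOrderParameter_le_of_canonical_upper_of_sourced_lower {U : ℝ} (hU : 0 ≤ U) (μ : ℝ) {n : ℝ}
    (hn0 : 0 ≤ n) (hn2 : n < 2) {hi : ℝ} (hhi : energyDensityTT' 1 0 U n ≤ hi) {h H ℓ : ℝ} (hh : 0 < h)
    (hhH : h < H)
    (hl : ∀ᶠ L : ℕ in atTop, ℓ * (((L + 1 : ℕ) : ℝ)) ^ 2 ≤ (dWaveSourceTorus (L + 1) U μ H).groundEnergy) :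
    dWaveOrderParameter U μ ≤ (hi - μ * n - ℓ) / (2 * (H - h)) := by
  have hHh : 0 < 2 * (H - h) := by linarith
  -- for every `ε > 0` the window `u₀ = hi − μ n + ε` is eventually available
  refine le_of_forall_pos_le_add fun ε hε => ?_
  have hu₀ : energyDensityTT' 1 0 U n - μ * n < hi - μ * n + ε * (2 * (H - h)) := by
    have hprod := mul_pos hε hHh
    linarith
  have hu := eventually_groundEnergy_dWaveSourceTorus_zero_le hU μ hn0 hn2 hu₀
  have hceil := dWaveOrderParameter_le_of_sourced_energy_window U μ hh hhH hu hl
  have heq : (hi - μ * n + ε * (2 * (H - h)) - ℓ) / (2 * (H - h)) = (hi - μ * n - ℓ) / (2 * (H - h)) + ε := by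
    rw [show hi - μ * n + ε * (2 * (H - h)) - ℓ = (hi - μ * n - ℓ) + ε * (2 * (H - h)) by ring, add_div,
      mul_div_cancel_right₀ ε hHh.ne']
  rw [heq] at hceil
  exact hceil

end Summit.Ventures.CertifiedManyBodySolver.Observables

end
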